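import Mathlib
import HarnessLib
import Literature.MathematicalPhysics.StatisticalMechanics.RenormalisationMapFreeHtLinearDecomposition
import Literature.MathematicalPhysics.StatisticalMechanics.RenormalisationMapSingleBlockKernelSecondDiff
import Literature.MathematicalPhysics.StatisticalMechanics.RenormalisationMapRemainderTwoLargeKernelSecondDiff
import Literature.MathematicalPhysics.StatisticalMechanics.RenormalisationMapRemaindersThreeFourKernelSecondDiff
import Literature.MathematicalPhysics.StatisticalMechanics.LinearisedMapBlockPartABKMQ

/-!
# `K_{k+1}` for FOUR STEP KERNELS (kernel SECOND DIFFERENCE) at a COMMON FREE intermediate Hamiltonian `H̃`: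
# glue and RAW per-polymer bound ([ABKM19] Definition 6.5 (6.34) ⊗ Lemma 8.4 (ℓ = 2); (12.53) at `ℓ = 2`, block B4)

For four step kernels `𝒞a, 𝒞b, 𝒞c, 𝒞e` (corners `q+y+z, q+y, q+z, q` of a parallelogram — or three points `q+2h, q+h, q+h, q` of a
line — of tuning parameters) at the SAME state `(H, K)` and the SAME free intermediate Hamiltonian `H̃`, the second difference
`nextK(μ_a) − nextK(μ_b) − nextK(μ_c) + nextK(μ_e)` of `K_{k+1} = nextK s π μ (e^{−H}) (e^{−H̃}) K` ([ABKM19] (6.34), AFFINE in the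
fluctuation measure at fixed `(I, Ĩ, K)`) is, by the four-family linear decomposition (`RenormalisationMapFreeHtLinearDecomposition`),
the sum of the second differences of the single-block family, of `Σ₂ᴸ`, of `Σ₃` and of `Σ₄` — each bounded by a landed kernel-only
second-order twin (`RenormalisationMapSingleBlockKernelSecondDiff`, `…RemainderTwoLargeKernelSecondDiff`, `…RemaindersThreeFourKernelSecondDiff`):

* **`tayNormLE_nextK_freeHt_kernelSecondDiff_abkm_raw_of_stepKernelBounds`** — on a connected `(k+1)`-polymer `U`, in
  `|·|_{T_{k+1}^{U*}, w_{k+1}^U}`, the second difference is at most `[single block, block form] + [Σ₂ᴸ] + [Σ₃] + [Σ₄]`, every term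
  LINEAR in the second-order pair constant `ℓ` of Lemma 8.4 (near-`U` form, `‖(R_a − R_b − R_c + R_e)F‖ ≤ b·ℓ·κ_p^{|Y|_k}`) and first
  order in `(‖H‖_{k,0}, C)`.

NO first-order twins, NO block part / `Σ₁` / defect terms occur (these are artefacts of the one-kernel regrouping).  Everything is
proved; no named fact.  Honest scope: block B4 of the stub `stub_f4l2ShrinkLoc` of the crux child `TwoKernelSkBound` (route
`Summits/HubbardSuperconductivity/…/Theses/ComplexGFFStiffness`, stiffness of a complex Gaussian gradient field via the [ABKM19] RG);
nothing about superconductivity in the Hubbard model is claimed.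

## References
* S. Adams, S. Buchholz, R. Kotecký, S. Müller, arXiv:1910.13564, Definition 6.5 (6.34), Theorem 6.8, Lemma 8.4, Lemma 9.6,
  Lemma 12.6 (12.53) [AdamsBuchholzKoteckyMuller2019].
-/

noncomputable section

namespace Literature.MathematicalPhysics.StatisticalMechanics.GradientRG

open scoped BigOperators Classical
open Finset MeasureTheory
open Literature.MathematicalPhysics.StatisticalMechanics.TorusPolymer
  (IsPolymer blocks polys bprod blockOf thicken reblock mem_polys mem_blocks numBlocks isPolymer_blockOf
    card_blocks_eq_numBlocks blocks_blockOf empty_mem_polys reblock_empty self_mem_polys)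
open Literature.Barriers.CriticalPhenomena.LongRangePhi4.Polymer (IsConn components)
open Literature.MathematicalPhysics.QuantumFieldTheory

variable {d M : ℕ} [NeZero M]

set_option maxHeartbeats 1600000 in
/-- **Raw four-kernel (second-difference) bound at a common free `H̃` on a connected `(k+1)`-polymer** (module docstring):
torus data `d ≥ 3`, `L` odd, `L ≥ 2^{d+3}+16R`, `R ≥ 2`, `M = L^N`, `k+1 ≤ N`, `⌊d/2⌋+1 ≤ min(p, M_ord)`; four step kernels with
`StepKernelBounds` relative to the `q = 0` weights and the second-order pair property near `U` (`(ℓ, κ_p)`); `‖H̃‖_{k,0} ≤ τ ≤ 1/16`,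
`‖H‖_{k,0} ≤ 1/16`, `‖K‖_k ≤ C` with `K` admissible, `K(∅) = 1`; letters `8e^{1/4}τ ≤ ω`, `16e^{1/4}‖H‖ ≤ ω`, `2C ≤ ω`, `ωA² ≤ 1`,
`1 + e^{1/4} ≤ κ`, `A ≥ 1`. [cite: AdamsBuchholzKoteckyMuller2019, Definition 6.5 (6.34) / Theorem 6.8 / Lemma 8.4 / Lemma 12.6 (12.53)] -/
theorem tayNormLE_nextK_freeHt_kernelSecondDiff_abkm_raw_of_stepKernelBounds {L N Mord R n p r₀ : ℕ}
    {θbar lam μ δ₁ δ₀ A𝒫 A𝒫a A𝒫b A𝒫c A𝒫e C₂a C₂b C₂c C₂e h A : ℝ}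
    {𝒞 : ℕ → (Fin d → ZMod M) → ℝ} (hd : 3 ≤ d) (hLodd : Odd L) (hL : 2 ^ (d + 3) + 16 * R ≤ L)
    (hR2 : 2 ≤ R) (hM : M = L ^ N) {k : ℕ} (hkN : k + 1 ≤ N)
    {𝒞a 𝒞b 𝒞c 𝒞e : (Fin d → ZMod M) → ℝ}
    (hSa : StepKernelBounds (abkmWeightData L N Mord R θbar (schedDelta δ₀ δ₁ N) 𝒞) L k A𝒫a C₂a 𝒞a)
    (hSb : StepKernelBounds (abkmWeightData L N Mord R θbar (schedDelta δ₀ δ₁ N) 𝒞) L k A𝒫b C₂b 𝒞b)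
    (hSc : StepKernelBounds (abkmWeightData L N Mord R θbar (schedDelta δ₀ δ₁ N) 𝒞) L k A𝒫c C₂c 𝒞c)
    (hSe : StepKernelBounds (abkmWeightData L N Mord R θbar (schedDelta δ₀ δ₁ N) 𝒞) L k A𝒫e C₂e 𝒞e)
    (hp : d / 2 + 1 ≤ p) (hMord : d / 2 + 1 ≤ Mord)
    (hB : AbkmWeightBounds L N Mord R n θbar lam μ δ₁ δ₀ A𝒫 𝒞
      (abkmWeightData L N Mord R θbar (schedDelta δ₀ δ₁ N) 𝒞))
    (hδ₀ : 0 < δ₀) (hδ₁ : 0 < δ₁) (hh : 0 < h) (hh0 : hZeroSq d R δ₀ δ₁ ≤ h ^ 2) (hA𝒫 : 0 ≤ A𝒫a) (hA1 : 1 ≤ A)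
    {U : Finset (Fin d → ZMod M)} (hU : IsPolymer (L ^ (k + 1)) U) (hUc : IsConn U)
    {Ht H : RelevantHamiltonian ℂ d} {τ : ℝ}
    (hHt : hamNorm (fieldWt h (L : ℝ) d k) ((L : ℝ) ^ k) (L ^ (d * k)) Ht ≤ τ) (hτ : τ ≤ 1 / 16)
    (hH : hamNorm (fieldWt h (L : ℝ) d k) ((L : ℝ) ^ k) (L ^ (d * k)) H ≤ 1 / 16)
    {K : Finset (Fin d → ZMod M) → ((Fin d → ZMod M) → ℝ) → ℂ} {C : ℝ} (hC : 0 ≤ C)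
    (hK : WeakNormLE (abkmNormParams L N Mord R p r₀ h θbar A (schedDelta δ₀ δ₁ N) 𝒞) k K C)
    (hKfac : Factorises (L ^ k) K) (hK0 : ∀ φ, K ∅ φ = 1) (hKd : ∀ Y, ContDiff ℝ r₀ (K Y))
    (hKloc : ∀ Y, IsPolymer (L ^ k) Y → IsConn Y →
      IsGaugeLocal ((abkmNormParams L N Mord R p r₀ h θbar A (schedDelta δ₀ δ₁ N) 𝒞).gauge k Y) (K Y))
    {ℓ κp : ℝ} (hℓ : 0 ≤ ℓ) (hκp : 0 ≤ κp)
    (hdiff : ∀ X : Finset (Fin d → ZMod M), IsPolymer (L ^ k) X → X ⊆ thicken ((2 ^ d - 1) * L ^ k) U →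
      ∀ (F : ((Fin d → ZMod M) → ℝ) → ℂ) (b : ℝ), 0 ≤ b → ContDiff ℝ r₀ F →
        IsGaugeLocal ((abkmNormParams L N Mord R p r₀ h θbar A (schedDelta δ₀ δ₁ N) 𝒞).gauge k X) F →
        TayNormLE ((abkmNormParams L N Mord R p r₀ h θbar A (schedDelta δ₀ δ₁ N) 𝒞).gauge k X) r₀
          ((abkmWeightData L N Mord R θbar (schedDelta δ₀ δ₁ N) 𝒞).weight k X) F b →
          TayNormLE ((abkmNormParams L N Mord R p r₀ h θbar A (schedDelta δ₀ δ₁ N) 𝒞).gauge k X) r₀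
            ((abkmWeightData L N Mord R θbar (schedDelta δ₀ δ₁ N) 𝒞).midWeight k X)
            (fluct 𝒞a F - fluct 𝒞b F - fluct 𝒞c F + fluct 𝒞e F) (b * ℓ * κp ^ numBlocks (L ^ k) X))
    {ω κ : ℝ}
    (hθω : 8 * Real.exp (1 / 4) * τ ≤ ω)
    (hbbω : 8 * Real.exp (1 / 4) * hamNorm (fieldWt h (L : ℝ) d k) ((L : ℝ) ^ k) (L ^ (d * k)) H +
      8 * Real.exp (1 / 4) * hamNorm (fieldWt h (L : ℝ) d k) ((L : ℝ) ^ k) (L ^ (d * k)) H ≤ ω)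
    (hCω : C + C ≤ ω) (hωA : ω * A ^ 2 ≤ 1)
    (hκ : 1 + Real.exp (1 / 4) ≤ κ) :
    TayNormLE ((abkmNormParams L N Mord R p r₀ h θbar A (schedDelta δ₀ δ₁ N) 𝒞).gauge (k + 1) U) r₀
      ((abkmWeightData L N Mord R θbar (schedDelta δ₀ δ₁ N) 𝒞).weight (k + 1) U)
      (fun φ => nextK (L ^ k) (reblock (L ^ k) (L * L ^ k)) (stepMeasure 𝒞a) (expNegH H) (expNegH Ht) K U φ -
        nextK (L ^ k) (reblock (L ^ k) (L * L ^ k)) (stepMeasure 𝒞b) (expNegH H) (expNegH Ht) K U φ -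
        nextK (L ^ k) (reblock (L ^ k) (L * L ^ k)) (stepMeasure 𝒞c) (expNegH H) (expNegH Ht) K U φ +
        nextK (L ^ k) (reblock (L ^ k) (L * L ^ k)) (stepMeasure 𝒞e) (expNegH H) (expNegH Ht) K U φ)
      (
      (2 * ((L ^ d : ℕ) : ℝ) * (Real.exp (1 / 4) ^ (L ^ d) * Real.exp (1 / 4)) *
        ((8 * Real.exp (1 / 4) * hamNorm (fieldWt h (L : ℝ) d k) ((L : ℝ) ^ k) (L ^ (d * k)) H + C * A⁻¹) * ℓ * κp) *
        (A * (abkmNormParams L N Mord R p r₀ h θbar A (schedDelta δ₀ δ₁ N) 𝒞).aFactor (k + 1) U)) +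
      (ℓ *
      ((κ ^ (blocks (L ^ k) U).card *
          ((8 * Real.exp (1 / 4) * hamNorm (fieldWt h (L : ℝ) d k) ((L : ℝ) ^ k) (L ^ (d * k)) H + C) *
            (ω * A ^ 4)) *
        (((2 * (2 * κ * max 1 (max A𝒫a κp))) ^ ((2 ^ (d + 1) + 2) ^ d * L ^ d) * (4 : ℝ) ^ ((2 ^ (d + 1) + 2) ^ d * L ^ d)) ^
            (blocks (L * L ^ k) U).card *
          A ^ (-((1 + 1 / ((2 * (2 ^ d + 1) + 6 : ℝ) ^ d)) * (blocks (L * L ^ k) U).card) : ℝ)) +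
      κ ^ (blocks (L ^ k) U).card * C *
        (((2 * κ * max 1 (max A𝒫a κp)) ^ ((2 ^ (d + 1) + 2) ^ d * L ^ d) * (2 : ℝ) ^ ((2 ^ (d + 1) + 2) ^ d * L ^ d)) ^
            (blocks (L * L ^ k) U).card *
          A ^ (-((1 + 1 / ((2 * (2 ^ d + 1) + 6 : ℝ) ^ d)) * (blocks (L * L ^ k) U).card) : ℝ))))) +
      (ℓ *
      (κ ^ (blocks (L ^ k) U).card *
          ((8 * Real.exp (1 / 4) * hamNorm (fieldWt h (L : ℝ) d k) ((L : ℝ) ^ k) (L ^ (d * k)) H + C) *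
            (ω * A ^ 4)) *
        (((2 * (2 * κ * max 1 (max A𝒫a κp))) ^ ((2 ^ (d + 1) + 2) ^ d * L ^ d) * (4 : ℝ) ^ ((2 ^ (d + 1) + 2) ^ d * L ^ d)) ^
            (blocks (L * L ^ k) U).card *
          A ^ (-((1 + 1 / ((2 * (2 ^ d + 1) + 6 : ℝ) ^ d)) * (blocks (L * L ^ k) U).card) : ℝ)))) +
      (ℓ *
      (κ ^ (blocks (L ^ k) U).card *
          ((8 * Real.exp (1 / 4) * hamNorm (fieldWt h (L : ℝ) d k) ((L : ℝ) ^ k) (L ^ (d * k)) H + C) *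
            (ω * A ^ 4)) *
        (((2 * (2 * κ * max 1 (max A𝒫a κp))) ^ ((2 ^ (d + 1) + 2) ^ d * L ^ d) * (4 : ℝ) ^ ((2 ^ (d + 1) + 2) ^ d * L ^ d)) ^
            (blocks (L * L ^ k) U).card *
          A ^ (-((1 + 1 / ((2 * (2 ^ d + 1) + 6 : ℝ) ^ d)) * (blocks (L * L ^ k) U).card) : ℝ))))) := by
  set P := abkmNormParams L N Mord R p r₀ h θbar A (schedDelta δ₀ δ₁ N) 𝒞 with hP
  set W := abkmWeightData L N Mord R θbar (schedDelta δ₀ δ₁ N) 𝒞 with hW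
  have hd2 : 2 ≤ d := by omega
  have hA : 0 < A := by linarith
  have hUne : U.Nonempty := hUc.1
  have hH8 : hamNorm (fieldWt h (L : ℝ) d k) ((L : ℝ) ^ k) (L ^ (d * k)) H ≤ 1 / 8 := hH.trans (by norm_num)
  set T := (polys (L ^ k) univ).filter (fun X => reblock (L ^ k) (L * L ^ k) X = U) with hT
  set T₁ := (blocks (L ^ k) univ).filter (fun B => TorusPolymer.closure (L * L ^ k) B = U) with hT₁
  have hMo : Odd M := by rw [hM]; exact hLodd.pow
  have hsodd : Odd (L ^ k) := hLodd.pow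
  have hTp : ∀ X ∈ T, IsPolymer (L ^ k) X := fun X hX => (mem_polys.1 (mem_filter.1 hX).1).2
  have hT₁T : T₁ ⊆ T := by
    have e : blockPartIndex (⟨L ^ k, L, 𝒞a, 0, ∅⟩ : StepData d M) U = T₁ := rfl
    rw [← e, ← filter_reblock_isConn_card_eq_one (⟨L ^ k, L, 𝒞a, 0, ∅⟩ : StepData d M) hMo hsodd hLodd U]
    exact filter_subset _ _
  have hT₂T : largePartIndex (L ^ k) L U ⊆ T := by
    intro X hX
    obtain ⟨hXp, -, -, hXU⟩ := mem_largePartIndex.1 hX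
    exact mem_filter.2 ⟨mem_polys.2 ⟨subset_univ _, hXp⟩, hXU⟩
  have hT₃T : T.filter (fun X => ¬ IsConn X) ⊆ T := filter_subset _ _
  have hpairp : ∀ X ∈ T, ∀ X₁ ∈ ({∅, X} : Finset (Finset (Fin d → ZMod M))), X₁ ∈ polys (L ^ k) X := by
    intro X hX X₁ hX₁
    rcases mem_insert.1 hX₁ with rfl | h1
    · exact empty_mem_polys _ _
    · rw [mem_singleton.1 h1]; exact self_mem_polys (hTp X hX)
  have heep : ∀ X ∈ T, ∀ X₁ ∈ ((polys (L ^ k) X).erase X).erase ∅, X₁ ∈ polys (L ^ k) X :=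
    fun X _ X₁ hX₁ => mem_of_mem_erase (mem_of_mem_erase hX₁)
  -- the four pieces
  have h1 := tayNormLE_singleBlock_kernelSecondDiff_abkm_blockFree (n := n) (lam := lam) (μ := μ) hd hLodd hL hR2 hM hkN
    hSa hSb hSc hSe hp hMord hB hδ₀ hδ₁ hh hh0 hA𝒫 hA1 hU hHt hτ hH hC hK hKfac hK0 hKd hKloc hℓ hκp hdiff
  have h2 := tayNormLE_remainderTwoLarge_kernelSecondDiff_abkm (n := n) (lam := lam) (μ := μ) hd hLodd hL hR2 hM hkN hSa hSb
    hSc hSe hp hMord hB hδ₀ hδ₁ hh hh0 hA𝒫 hA1 hU hHt hτ hH hC hK hKfac hK0 hKd hKloc hℓ hκp hdiff hθω hbbω hCω hωA hκ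
  have h3 := tayNormLE_remainderThree_kernelSecondDiff_abkm (n := n) (lam := lam) (μ := μ) hd hLodd hL hR2 hM hkN hSa hSb
    hSc hSe hp hMord hB hδ₀ hδ₁ hh hh0 hA𝒫 hA1 hU hUne hHt hτ hH hC hK hKfac hK0 hKd hKloc hℓ hκp hdiff hθω hbbω hCω hωA hκ
  have h4 := tayNormLE_remainderFour_kernelSecondDiff_abkm (n := n) (lam := lam) (μ := μ) hd hLodd hL hR2 hM hkN hSa hSb
    hSc hSe hp hMord hB hδ₀ hδ₁ hh hh0 hA𝒫 hA1 hU hHt hτ hH hC hK hKfac hK0 hKd hKloc hℓ hκp hdiff hθω hbbω hCω hωA hκ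
  -- smoothness of the summands
  have hsubd : ∀ {𝒞q : (Fin d → ZMod M) → ℝ} {A𝒫q C₂q : ℝ},
      StepKernelBounds W L k A𝒫q C₂q 𝒞q → ∀ X ∈ T, ∀ X₁ ∈ polys (L ^ k) X,
      ContDiff ℝ r₀ (fun φ : (Fin d → ZMod M) → ℝ =>
        bprod (L ^ k) (fun B => expNegH Ht B φ) (U \ X) * bprod (L ^ k) (fun B => expNegH (-Ht) B φ) (X \ U) *
            (bprod (L ^ k) (fun B => 1 - expNegH Ht B φ) X₁ * fluct 𝒞q (polyP2 (L ^ k) H K (X \ X₁)) φ)) :=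
    fun hSq X hX X₁ hX₁ => contDiff_reblockSub_abkm_of_stepKernelBounds hd2 hLodd hM hkN hSq hp hMord hB hδ₀ hδ₁ hh hh0 hA
      (hTp X hX) hX₁ Ht hH8 hC hK hKfac hK0 hKd hKloc U
  have htopd : ∀ {𝒞q : (Fin d → ZMod M) → ℝ} {A𝒫q C₂q : ℝ},
      StepKernelBounds W L k A𝒫q C₂q 𝒞q → ∀ X ∈ T,
      ContDiff ℝ r₀ (fun φ : (Fin d → ZMod M) → ℝ =>
        bprod (L ^ k) (fun B => expNegH Ht B φ) (U \ X) * bprod (L ^ k) (fun B => expNegH (-Ht) B φ) (X \ U) *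
            (fluct 𝒞q (polyP2 (L ^ k) H K X) φ + bprod (L ^ k) (fun B => 1 - expNegH Ht B φ) X)) :=
    fun hSq X hX => contDiff_reblockTop_abkm_of_stepKernelBounds hd2 hLodd hM hkN hSq hp hMord hB hδ₀ hδ₁ hh hh0 hA
      (hTp X hX) Ht hH8 hC hK hKfac hK0 hKd hKloc U
  have hF1d : ContDiff ℝ r₀ (fun φ => ∑ X ∈ (blocks (L ^ k) univ).filter (fun B => TorusPolymer.closure (L * L ^ k) B = U),
        ∑ X₁ ∈ ({∅, X} : Finset (Finset (Fin d → ZMod M))),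
        (bprod (L ^ k) (fun B => expNegH Ht B φ) (U \ X) * bprod (L ^ k) (fun B => expNegH (-Ht) B φ) (X \ U) *
            (bprod (L ^ k) (fun B => 1 - expNegH Ht B φ) X₁ * fluct 𝒞a (polyP2 (L ^ k) H K (X \ X₁)) φ) -
          bprod (L ^ k) (fun B => expNegH Ht B φ) (U \ X) * bprod (L ^ k) (fun B => expNegH (-Ht) B φ) (X \ U) *
            (bprod (L ^ k) (fun B => 1 - expNegH Ht B φ) X₁ * fluct 𝒞b (polyP2 (L ^ k) H K (X \ X₁)) φ) -
          bprod (L ^ k) (fun B => expNegH Ht B φ) (U \ X) * bprod (L ^ k) (fun B => expNegH (-Ht) B φ) (X \ U) *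
            (bprod (L ^ k) (fun B => 1 - expNegH Ht B φ) X₁ * fluct 𝒞c (polyP2 (L ^ k) H K (X \ X₁)) φ) +
          bprod (L ^ k) (fun B => expNegH Ht B φ) (U \ X) * bprod (L ^ k) (fun B => expNegH (-Ht) B φ) (X \ U) *
            (bprod (L ^ k) (fun B => 1 - expNegH Ht B φ) X₁ * fluct 𝒞e (polyP2 (L ^ k) H K (X \ X₁)) φ))) := by
    refine ContDiff.sum fun X hX => ContDiff.sum fun X₁ hX₁ => ?_
    have hXT := hT₁T hX
    have hX₁p := hpairp X hXT X₁ hX₁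
    exact (((hsubd hSa X hXT X₁ hX₁p).sub (hsubd hSb X hXT X₁ hX₁p)).sub (hsubd hSc X hXT X₁ hX₁p)).add
      (hsubd hSe X hXT X₁ hX₁p)
  have hF2d : ContDiff ℝ r₀ (fun φ => ∑ X ∈ largePartIndex (L ^ k) L U,
        (bprod (L ^ k) (fun B => expNegH Ht B φ) (U \ X) * bprod (L ^ k) (fun B => expNegH (-Ht) B φ) (X \ U) *
            (fluct 𝒞a (polyP2 (L ^ k) H K X) φ + bprod (L ^ k) (fun B => 1 - expNegH Ht B φ) X) -
          bprod (L ^ k) (fun B => expNegH Ht B φ) (U \ X) * bprod (L ^ k) (fun B => expNegH (-Ht) B φ) (X \ U) *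
            (fluct 𝒞b (polyP2 (L ^ k) H K X) φ + bprod (L ^ k) (fun B => 1 - expNegH Ht B φ) X) -
          bprod (L ^ k) (fun B => expNegH Ht B φ) (U \ X) * bprod (L ^ k) (fun B => expNegH (-Ht) B φ) (X \ U) *
            (fluct 𝒞c (polyP2 (L ^ k) H K X) φ + bprod (L ^ k) (fun B => 1 - expNegH Ht B φ) X) +
          bprod (L ^ k) (fun B => expNegH Ht B φ) (U \ X) * bprod (L ^ k) (fun B => expNegH (-Ht) B φ) (X \ U) *
            (fluct 𝒞e (polyP2 (L ^ k) H K X) φ + bprod (L ^ k) (fun B => 1 - expNegH Ht B φ) X))) := by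
    refine ContDiff.sum fun X hX => ?_
    have hXT := hT₂T hX
    exact (((htopd hSa X hXT).sub (htopd hSb X hXT)).sub (htopd hSc X hXT)).add (htopd hSe X hXT)
  have hF3d : ContDiff ℝ r₀ (fun φ => ∑ X ∈ ((polys (L ^ k) univ).filter (fun X => reblock (L ^ k) (L * L ^ k) X = U)).filter
          (fun X => ¬ IsConn X),
        (bprod (L ^ k) (fun B => expNegH Ht B φ) (U \ X) * bprod (L ^ k) (fun B => expNegH (-Ht) B φ) (X \ U) *
            (fluct 𝒞a (polyP2 (L ^ k) H K X) φ + bprod (L ^ k) (fun B => 1 - expNegH Ht B φ) X) -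
          bprod (L ^ k) (fun B => expNegH Ht B φ) (U \ X) * bprod (L ^ k) (fun B => expNegH (-Ht) B φ) (X \ U) *
            (fluct 𝒞b (polyP2 (L ^ k) H K X) φ + bprod (L ^ k) (fun B => 1 - expNegH Ht B φ) X) -
          bprod (L ^ k) (fun B => expNegH Ht B φ) (U \ X) * bprod (L ^ k) (fun B => expNegH (-Ht) B φ) (X \ U) *
            (fluct 𝒞c (polyP2 (L ^ k) H K X) φ + bprod (L ^ k) (fun B => 1 - expNegH Ht B φ) X) +
          bprod (L ^ k) (fun B => expNegH Ht B φ) (U \ X) * bprod (L ^ k) (fun B => expNegH (-Ht) B φ) (X \ U) *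
            (fluct 𝒞e (polyP2 (L ^ k) H K X) φ + bprod (L ^ k) (fun B => 1 - expNegH Ht B φ) X))) := by
    refine ContDiff.sum fun X hX => ?_
    have hXT := hT₃T hX
    exact (((htopd hSa X hXT).sub (htopd hSb X hXT)).sub (htopd hSc X hXT)).add (htopd hSe X hXT)
  have hF4d : ContDiff ℝ r₀ (fun φ => ∑ X ∈ (polys (L ^ k) univ).filter (fun X => reblock (L ^ k) (L * L ^ k) X = U),
        ∑ X₁ ∈ ((polys (L ^ k) X).erase X).erase ∅,
        (bprod (L ^ k) (fun B => expNegH Ht B φ) (U \ X) * bprod (L ^ k) (fun B => expNegH (-Ht) B φ) (X \ U) *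
            (bprod (L ^ k) (fun B => 1 - expNegH Ht B φ) X₁ * fluct 𝒞a (polyP2 (L ^ k) H K (X \ X₁)) φ) -
          bprod (L ^ k) (fun B => expNegH Ht B φ) (U \ X) * bprod (L ^ k) (fun B => expNegH (-Ht) B φ) (X \ U) *
            (bprod (L ^ k) (fun B => 1 - expNegH Ht B φ) X₁ * fluct 𝒞b (polyP2 (L ^ k) H K (X \ X₁)) φ) -
          bprod (L ^ k) (fun B => expNegH Ht B φ) (U \ X) * bprod (L ^ k) (fun B => expNegH (-Ht) B φ) (X \ U) *
            (bprod (L ^ k) (fun B => 1 - expNegH Ht B φ) X₁ * fluct 𝒞c (polyP2 (L ^ k) H K (X \ X₁)) φ) +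
          bprod (L ^ k) (fun B => expNegH Ht B φ) (U \ X) * bprod (L ^ k) (fun B => expNegH (-Ht) B φ) (X \ U) *
            (bprod (L ^ k) (fun B => 1 - expNegH Ht B φ) X₁ * fluct 𝒞e (polyP2 (L ^ k) H K (X \ X₁)) φ))) := by
    refine ContDiff.sum fun X hX => ContDiff.sum fun X₁ hX₁ => ?_
    have hX₁p := heep X hX X₁ hX₁
    exact (((hsubd hSa X hX X₁ hX₁p).sub (hsubd hSb X hX X₁ hX₁p)).sub (hsubd hSc X hX X₁ hX₁p)).add
      (hsubd hSe X hX X₁ hX₁p)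
  -- the four-family decomposition for each kernel
  have hdec : ∀ {𝒞q : (Fin d → ZMod M) → ℝ} {A𝒫q C₂q : ℝ},
      StepKernelBounds W L k A𝒫q C₂q 𝒞q → ∀ φ : (Fin d → ZMod M) → ℝ,
      nextK (L ^ k) (reblock (L ^ k) (L * L ^ k)) (stepMeasure 𝒞q) (expNegH H) (expNegH Ht) K U φ =
      (∑ X ∈ T₁, ∑ X₁ ∈ ({∅, X} : Finset (Finset (Fin d → ZMod M))),
          bprod (L ^ k) (fun B => expNegH Ht B φ) (U \ X) * bprod (L ^ k) (fun B => expNegH (-Ht) B φ) (X \ U) *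
            (bprod (L ^ k) (fun B => 1 - expNegH Ht B φ) X₁ * fluct 𝒞q (polyP2 (L ^ k) H K (X \ X₁)) φ)) +
      (∑ X ∈ largePartIndex (L ^ k) L U,
        bprod (L ^ k) (fun B => expNegH Ht B φ) (U \ X) * bprod (L ^ k) (fun B => expNegH (-Ht) B φ) (X \ U) *
          (fluct 𝒞q (polyP2 (L ^ k) H K X) φ + bprod (L ^ k) (fun B => 1 - expNegH Ht B φ) X)) +
      (∑ X ∈ T.filter (fun X => ¬ IsConn X),
        bprod (L ^ k) (fun B => expNegH Ht B φ) (U \ X) * bprod (L ^ k) (fun B => expNegH (-Ht) B φ) (X \ U) *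
          (fluct 𝒞q (polyP2 (L ^ k) H K X) φ + bprod (L ^ k) (fun B => 1 - expNegH Ht B φ) X)) +
      ∑ X ∈ T, ∑ X₁ ∈ ((polys (L ^ k) X).erase X).erase ∅,
          bprod (L ^ k) (fun B => expNegH Ht B φ) (U \ X) * bprod (L ^ k) (fun B => expNegH (-Ht) B φ) (X \ U) *
            (bprod (L ^ k) (fun B => 1 - expNegH Ht B φ) X₁ * fluct 𝒞q (polyP2 (L ^ k) H K (X \ X₁)) φ) := by
    intro 𝒞q A𝒫q C₂q hSq φ
    have e := nextK_freeHt_eq_four_abkm_of_stepKernelBounds (n := n) (lam := lam) (μ := μ) (p := p) (r₀ := r₀) (A := A) hd2 hLodd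
      hM hkN hp hMord hB hδ₀ hδ₁ hh hh0 hA (⟨L ^ k, L, 𝒞q, 0, ∅⟩ : StepData d M) rfl rfl hSq hH8 Ht hC hK hKfac hK0 hKd hKloc
      hUne φ
    simp only at e
    exact e
  -- the identity `ΔΔ nextK = F₁ + F₂ + F₃ + F₄`
  have hfun : (fun φ => nextK (L ^ k) (reblock (L ^ k) (L * L ^ k)) (stepMeasure 𝒞a) (expNegH H) (expNegH Ht) K U φ -
        nextK (L ^ k) (reblock (L ^ k) (L * L ^ k)) (stepMeasure 𝒞b) (expNegH H) (expNegH Ht) K U φ -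
        nextK (L ^ k) (reblock (L ^ k) (L * L ^ k)) (stepMeasure 𝒞c) (expNegH H) (expNegH Ht) K U φ +
        nextK (L ^ k) (reblock (L ^ k) (L * L ^ k)) (stepMeasure 𝒞e) (expNegH H) (expNegH Ht) K U φ) =
      (((fun φ => ∑ X ∈ (blocks (L ^ k) univ).filter (fun B => TorusPolymer.closure (L * L ^ k) B = U),
        ∑ X₁ ∈ ({∅, X} : Finset (Finset (Fin d → ZMod M))),
        (bprod (L ^ k) (fun B => expNegH Ht B φ) (U \ X) * bprod (L ^ k) (fun B => expNegH (-Ht) B φ) (X \ U) *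
            (bprod (L ^ k) (fun B => 1 - expNegH Ht B φ) X₁ * fluct 𝒞a (polyP2 (L ^ k) H K (X \ X₁)) φ) -
          bprod (L ^ k) (fun B => expNegH Ht B φ) (U \ X) * bprod (L ^ k) (fun B => expNegH (-Ht) B φ) (X \ U) *
            (bprod (L ^ k) (fun B => 1 - expNegH Ht B φ) X₁ * fluct 𝒞b (polyP2 (L ^ k) H K (X \ X₁)) φ) -
          bprod (L ^ k) (fun B => expNegH Ht B φ) (U \ X) * bprod (L ^ k) (fun B => expNegH (-Ht) B φ) (X \ U) *
            (bprod (L ^ k) (fun B => 1 - expNegH Ht B φ) X₁ * fluct 𝒞c (polyP2 (L ^ k) H K (X \ X₁)) φ) +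
          bprod (L ^ k) (fun B => expNegH Ht B φ) (U \ X) * bprod (L ^ k) (fun B => expNegH (-Ht) B φ) (X \ U) *
            (bprod (L ^ k) (fun B => 1 - expNegH Ht B φ) X₁ * fluct 𝒞e (polyP2 (L ^ k) H K (X \ X₁)) φ))) + (fun φ => ∑ X ∈ largePartIndex (L ^ k) L U,
        (bprod (L ^ k) (fun B => expNegH Ht B φ) (U \ X) * bprod (L ^ k) (fun B => expNegH (-Ht) B φ) (X \ U) *
            (fluct 𝒞a (polyP2 (L ^ k) H K X) φ + bprod (L ^ k) (fun B => 1 - expNegH Ht B φ) X) -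
          bprod (L ^ k) (fun B => expNegH Ht B φ) (U \ X) * bprod (L ^ k) (fun B => expNegH (-Ht) B φ) (X \ U) *
            (fluct 𝒞b (polyP2 (L ^ k) H K X) φ + bprod (L ^ k) (fun B => 1 - expNegH Ht B φ) X) -
          bprod (L ^ k) (fun B => expNegH Ht B φ) (U \ X) * bprod (L ^ k) (fun B => expNegH (-Ht) B φ) (X \ U) *
            (fluct 𝒞c (polyP2 (L ^ k) H K X) φ + bprod (L ^ k) (fun B => 1 - expNegH Ht B φ) X) +
          bprod (L ^ k) (fun B => expNegH Ht B φ) (U \ X) * bprod (L ^ k) (fun B => expNegH (-Ht) B φ) (X \ U) *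
            (fluct 𝒞e (polyP2 (L ^ k) H K X) φ + bprod (L ^ k) (fun B => 1 - expNegH Ht B φ) X)))) + (fun φ => ∑ X ∈ ((polys (L ^ k) univ).filter (fun X => reblock (L ^ k) (L * L ^ k) X = U)).filter
          (fun X => ¬ IsConn X),
        (bprod (L ^ k) (fun B => expNegH Ht B φ) (U \ X) * bprod (L ^ k) (fun B => expNegH (-Ht) B φ) (X \ U) *
            (fluct 𝒞a (polyP2 (L ^ k) H K X) φ + bprod (L ^ k) (fun B => 1 - expNegH Ht B φ) X) -
          bprod (L ^ k) (fun B => expNegH Ht B φ) (U \ X) * bprod (L ^ k) (fun B => expNegH (-Ht) B φ) (X \ U) *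
            (fluct 𝒞b (polyP2 (L ^ k) H K X) φ + bprod (L ^ k) (fun B => 1 - expNegH Ht B φ) X) -
          bprod (L ^ k) (fun B => expNegH Ht B φ) (U \ X) * bprod (L ^ k) (fun B => expNegH (-Ht) B φ) (X \ U) *
            (fluct 𝒞c (polyP2 (L ^ k) H K X) φ + bprod (L ^ k) (fun B => 1 - expNegH Ht B φ) X) +
          bprod (L ^ k) (fun B => expNegH Ht B φ) (U \ X) * bprod (L ^ k) (fun B => expNegH (-Ht) B φ) (X \ U) *
            (fluct 𝒞e (polyP2 (L ^ k) H K X) φ + bprod (L ^ k) (fun B => 1 - expNegH Ht B φ) X)))) + (fun φ => ∑ X ∈ (polys (L ^ k) univ).filter (fun X => reblock (L ^ k) (L * L ^ k) X = U),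
        ∑ X₁ ∈ ((polys (L ^ k) X).erase X).erase ∅,
        (bprod (L ^ k) (fun B => expNegH Ht B φ) (U \ X) * bprod (L ^ k) (fun B => expNegH (-Ht) B φ) (X \ U) *
            (bprod (L ^ k) (fun B => 1 - expNegH Ht B φ) X₁ * fluct 𝒞a (polyP2 (L ^ k) H K (X \ X₁)) φ) -
          bprod (L ^ k) (fun B => expNegH Ht B φ) (U \ X) * bprod (L ^ k) (fun B => expNegH (-Ht) B φ) (X \ U) *
            (bprod (L ^ k) (fun B => 1 - expNegH Ht B φ) X₁ * fluct 𝒞b (polyP2 (L ^ k) H K (X \ X₁)) φ) -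
          bprod (L ^ k) (fun B => expNegH Ht B φ) (U \ X) * bprod (L ^ k) (fun B => expNegH (-Ht) B φ) (X \ U) *
            (bprod (L ^ k) (fun B => 1 - expNegH Ht B φ) X₁ * fluct 𝒞c (polyP2 (L ^ k) H K (X \ X₁)) φ) +
          bprod (L ^ k) (fun B => expNegH Ht B φ) (U \ X) * bprod (L ^ k) (fun B => expNegH (-Ht) B φ) (X \ U) *
            (bprod (L ^ k) (fun B => 1 - expNegH Ht B φ) X₁ * fluct 𝒞e (polyP2 (L ^ k) H K (X \ X₁)) φ))) := by
    funext φ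
    simp only [Pi.add_apply]
    rw [hdec hSa φ, hdec hSb φ, hdec hSc φ, hdec hSe φ]
    simp only [sum_add_distrib, sum_sub_distrib]
    ring
  rw [hfun]
  exact ((h1.add h2 hF1d hF2d).add h3 (hF1d.add hF2d) hF3d).add h4 ((hF1d.add hF2d).add hF3d) hF4d

end Literature.MathematicalPhysics.StatisticalMechanics.GradientRG

end
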